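import Mathlib
import Literature.Analysis.FunctionSpaces.PlancherelL1L2

/-!
# The quadratic form of a convolution operator is bounded by the supremum of the symbol

Topic `Literature/Analysis/FunctionSpaces`. For `G ∈ L¹(ℝ)` and `Ψ ∈ L¹ ∩ L²(ℝ)` (with
`G ⋆ Ψ ∈ L¹ ∩ L²`), the polarized Plancherel identity and the convolution theorem give
`∫ conj(Ψ) · (G ⋆ Ψ) = ∫ 𝓕G(ξ) ‖𝓕Ψ(ξ)‖² dξ`, hence
**`Re ∫ conj(Ψ)(G ⋆ Ψ) ≤ (sup_ξ Re 𝓕G(ξ)) ‖Ψ‖²_{L²}`** (`re_integral_conj_mul_convolution_le`):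
a convolution operator is a Fourier multiplier with symbol `𝓕G`, so its numerical range lies below
`sup Re 𝓕G` (Stein–Weiss, *Introduction to Fourier Analysis on Euclidean Spaces*, Ch. I §§1–2;
Titchmarsh, *Fourier Integrals*, Thm 48 (Plancherel) and Thm 41 (convolution)).
Mathlib supplies the `L²` Fourier transform as an isometry (`MeasureTheory.Lp.inner_fourier_eq`) and
the convolution theorem for integrable functions (`Real.fourier_mul_convolution_eq`); the tree's
`PlancherelL1L2` identifies the `L²` transform with the Fourier integral on `L¹ ∩ L²`
(`fourier_toLp_ae_eq_fourierIntegral`).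

Consumed by the Eisenstein-free proof of Iwaniec's pretrace estimate (12.5): in the cusps an
invariant integral operator acts on functions of the height as a convolution in `log y` with the
profile `g` of (1.62), whose Fourier transform is the Selberg/Harish-Chandra transform `h`; this
lemma bounds that action by `sup_{t ∈ ℝ} h(t)`.

Everything here is proved; there are no definitions.

## References
* E. C. Titchmarsh, *Introduction to the Theory of Fourier Integrals*, 2nd ed., Oxford 1948,
  Thm 48 (Plancherel), §2.1 & Thm 41 (transform of a resultant/convolution).
* E. M. Stein, G. Weiss, *Introduction to Fourier Analysis on Euclidean Spaces*, Princeton 1971,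
  Ch. I §1 (Thm 1.4: `(f ⋆ g)^ = f̂ ĝ`) and §2 (Plancherel). [SteinWeiss1971]
-/

noncomputable section

open MeasureTheory FourierTransform Complex Set Filter Convolution
open scoped ENNReal Topology Real ComplexConjugate InnerProductSpace

namespace Literature.Analysis.FunctionSpaces

/-- **Polarized Plancherel identity on `L¹ ∩ L²(ℝ)`**: `∫ conj(f) g = ∫ conj(𝓕f) 𝓕g` for
`f, g ∈ L¹(ℝ) ∩ L²(ℝ)` (the inner product of `L²(ℝ)` is preserved by the Fourier transform, and on
`L¹ ∩ L²` the `L²` transform is the Fourier integral). [cite: SteinWeiss1971, Ch. I §2, Thm 2.1 (Plancherel)] -/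
theorem integral_conj_mul_eq_integral_conj_fourier_mul {f g : ℝ → ℂ}
    (hf1 : Integrable f) (hf2 : MemLp f 2) (hg1 : Integrable g) (hg2 : MemLp g 2) :
    ∫ x, conj (f x) * g x = ∫ ξ, conj (𝓕 f ξ) * 𝓕 g ξ := by
  set F : Lp ℂ 2 (volume : Measure ℝ) := hf2.toLp f with hF
  set Gl : Lp ℂ 2 (volume : Measure ℝ) := hg2.toLp g with hG
  have h1 : ⟪F, Gl⟫_ℂ = ∫ x, conj (f x) * g x := by
    rw [MeasureTheory.L2.inner_def]
    refine integral_congr_ae ?_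
    filter_upwards [hf2.coeFn_toLp, hg2.coeFn_toLp] with x hx hy
    rw [RCLike.inner_apply, hF, hG, hx, hy, mul_comm]
  have h2 : ⟪(𝓕 F : Lp ℂ 2 (volume : Measure ℝ)), (𝓕 Gl : Lp ℂ 2 (volume : Measure ℝ))⟫_ℂ =
      ∫ ξ, conj (𝓕 f ξ) * 𝓕 g ξ := by
    rw [MeasureTheory.L2.inner_def]
    refine integral_congr_ae ?_
    filter_upwards [fourier_toLp_ae_eq_fourierIntegral hf1 hf2, fourier_toLp_ae_eq_fourierIntegral hg1 hg2]
      with ξ hx hy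
    rw [RCLike.inner_apply, mul_comm, hx, hy]
  rw [← h1, ← MeasureTheory.Lp.inner_fourier_eq F Gl, h2]

/-- The Fourier integral of an integrable function is bounded by its `L¹` norm. [folklore] -/
theorem norm_fourierIntegral_le_integral_norm {G : ℝ → ℂ} (ξ : ℝ) :
    ‖𝓕 G ξ‖ ≤ ∫ x, ‖G x‖ := by
  rw [Real.fourier_eq]
  refine (norm_integral_le_integral_norm _).trans (le_of_eq ?_)
  congr 1 with x
  rw [Circle.norm_smul]

/-- **The quadratic form of a convolution operator is bounded by the supremum of its symbol.**
For `G ∈ L¹(ℝ)`, `Ψ ∈ L¹ ∩ L²(ℝ)` with `G ⋆ Ψ ∈ L¹ ∩ L²(ℝ)`, and `Re 𝓕G ≤ β` pointwise: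
`Re ∫ conj(Ψ(x)) (G ⋆ Ψ)(x) dx ≤ β ∫ ‖Ψ‖²`. Indeed the left side equals `∫ 𝓕G(ξ) ‖𝓕Ψ(ξ)‖² dξ`
by the polarized Plancherel identity and `𝓕(G ⋆ Ψ) = 𝓕G · 𝓕Ψ`, and `∫ ‖𝓕Ψ‖² = ∫ ‖Ψ‖²`.
[cite: SteinWeiss1971, Ch. I §1 Thm 1.4 & §2 Thm 2.1] -/
theorem re_integral_conj_mul_convolution_le {G Ψ : ℝ → ℂ} (hG : Integrable G)
    (hΨ1 : Integrable Ψ) (hΨ2 : MemLp Ψ 2)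
    (hC1 : Integrable (G ⋆[ContinuousLinearMap.mul ℂ ℂ] Ψ))
    (hC2 : MemLp (G ⋆[ContinuousLinearMap.mul ℂ ℂ] Ψ) 2)
    {β : ℝ} (hβ : ∀ ξ, (𝓕 G ξ).re ≤ β) :
    (∫ x, conj (Ψ x) * (G ⋆[ContinuousLinearMap.mul ℂ ℂ] Ψ) x).re ≤ β * ∫ x, ‖Ψ x‖ ^ 2 := by
  rw [integral_conj_mul_eq_integral_conj_fourier_mul hΨ1 hΨ2 hC1 hC2]
  -- `𝓕(G ⋆ Ψ) = 𝓕G · 𝓕Ψ`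
  have hconv : ∀ ξ, 𝓕 (G ⋆[ContinuousLinearMap.mul ℂ ℂ] Ψ) ξ = 𝓕 G ξ * 𝓕 Ψ ξ :=
    fun ξ => Real.fourier_mul_convolution_eq hG hΨ1 ξ
  have hpt : ∀ ξ, conj (𝓕 Ψ ξ) * 𝓕 (G ⋆[ContinuousLinearMap.mul ℂ ℂ] Ψ) ξ =
      𝓕 G ξ * ((‖𝓕 Ψ ξ‖ ^ 2 : ℝ) : ℂ) := by
    intro ξ
    rw [hconv, Complex.ofReal_pow, ← Complex.conj_mul' (𝓕 Ψ ξ)]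
    ring
  simp_rw [hpt]
  -- integrability of both sides
  have hB : ∀ ξ, ‖𝓕 G ξ‖ ≤ ∫ x, ‖G x‖ := fun ξ => norm_fourierIntegral_le_integral_norm ξ
  have hFΨ : MemLp (𝓕 Ψ) 2 (volume : Measure ℝ) := memLp_two_fourierIntegral hΨ1 hΨ2
  have hsq : Integrable (fun ξ => ‖𝓕 Ψ ξ‖ ^ 2) (volume : Measure ℝ) :=
    (memLp_two_iff_integrable_sq_norm hFΨ.1).1 hFΨ
  have hGc : Continuous (𝓕 G) := continuous_fourierIntegral hG
  have hint : Integrable (fun ξ => 𝓕 G ξ * ((‖𝓕 Ψ ξ‖ ^ 2 : ℝ) : ℂ)) (volume : Measure ℝ) := by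
    refine Integrable.bdd_mul (c := ∫ x, ‖G x‖) (hsq.ofReal) hGc.aestronglyMeasurable
      (Eventually.of_forall hB)
  have hre_pt : ∀ ξ, (𝓕 G ξ * ((‖𝓕 Ψ ξ‖ ^ 2 : ℝ) : ℂ)).re = (𝓕 G ξ).re * ‖𝓕 Ψ ξ‖ ^ 2 := by
    intro ξ
    rw [Complex.mul_re, Complex.ofReal_re, Complex.ofReal_im, mul_zero, sub_zero]
  have hint_re : Integrable (fun ξ => (𝓕 G ξ).re * ‖𝓕 Ψ ξ‖ ^ 2) (volume : Measure ℝ) := by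
    have := hint.re
    refine this.congr (Eventually.of_forall fun ξ => ?_)
    exact hre_pt ξ
  have hre : (∫ ξ, 𝓕 G ξ * ((‖𝓕 Ψ ξ‖ ^ 2 : ℝ) : ℂ)).re = ∫ ξ, (𝓕 G ξ).re * ‖𝓕 Ψ ξ‖ ^ 2 := by
    have h := integral_re hint
    simp only [RCLike.re_to_complex] at h
    rw [← h]
    exact integral_congr_ae (Eventually.of_forall hre_pt)
  rw [hre, ← integral_norm_sq_fourierIntegral_eq hΨ1 hΨ2, ← integral_const_mul]
  exact integral_mono hint_re (hsq.const_mul β) fun ξ =>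
    mul_le_mul_of_nonneg_right (hβ ξ) (by positivity)

end Literature.Analysis.FunctionSpaces

end
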